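import Summits.NavierStokesRegularity.NavierStokesRegularity.Theorems.SelfMixingDichotomySequentialTypeIExclusionSupFormOfNoLocalTypeI
import HarnessLib

/-!
# Route SelfMixingDichotomy · crux `SequentialTypeIExclusion` (S1): the sup-form from
# `¬ LocalTypeISingularityExists` at points without Type-II spikes (sequel)

Helper file of the crux item stmt-NavierStokesRegularity-1424 (lands `--supports` that item; line
`registered`, lead c5); sequel of `…SupFormOfNoLocalTypeI.lean`, which derives boundedness near a
final-time point from the SHARED conjecture `¬ LocalTypeISingularityExists` under a sub-ball
(Morrey) cubic bound (`supForm_of_not_localTypeISingularityExists_of_subballC`). Here: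

* `subballC_of_supForm_of_relTypeI` — the CENTRED cubic Type-I bound of `S1_sup` plus a pointwise
  Type-I rate RELATIVE TO THE POINT, `max(‖x − x₀‖, √(T − t)) ‖u(t,x)‖ ≤ K` on some `Q_{r₂}(T, x₀)`,
  give the sub-ball bound (sub-balls far from `(T, x₀)` in parabolic distance see `‖u‖ ≤ K/r'`,
  near ones sit inside `Q_{3r'}(T, x₀)`; no singular integral is needed);
* `supForm_of_not_localTypeISingularityExists_of_relTypeI` — HENCE `S1_sup` holds, from
  `¬ LocalTypeISingularityExists` alone, at every point where the blow-up carries no Type-II spikes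
  relative to the point;
* `typeIISpikes_of_not_bdd_of_not_localTypeISingularityExists` — equivalently, at a centred-Type-I
  final-time point which is NOT bounded, `sup_{Q_r(T,x₀)} max(‖x − x₀‖, √(T − t)) ‖u‖ = ∞` for
  every `r > 0`: thin spikes of super-Type-I amplitude (regular points of `u` before `T`, cheap in
  `L³`, invisible to the centred scale-invariant quantities) must accumulate at the point.

So, for S1, the gap between the route's centred conjecture `¬ TypeISingularityExists` (from which the
tree derives `S1_sup`, `supForm_of_not_typeISingularityExists`) and the shared
`¬ LocalTypeISingularityExists` (⇐ (L), in tree) is exactly the scenario "centred Type-I point with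
accumulating Type-II spikes".

## References

* D. Albritton, T. Barker, J. Math. Fluid Mech. 21 (2019) = arXiv:1811.00502, Thm. 1.1, Lemma 2.6.
  [AlbrittonBarker2019]
* G. Seregin, V. Šverák, Comm. PDE 34 (2009) 171–201 = arXiv:0804.1803, §2. [SereginSverak2009]
* G. Koch, N. Nadirashvili, G. Seregin, V. Šverák, Acta Math. 203 (2009) 83–105 (conjecture (L)). [KNSS2009]
-/

noncomputable section

set_option linter.dupNamespace false -- nested layout Summit.<S>.<Sub>, Sub = S (D-0017)

open Set Filter Topology MeasureTheory

namespace Summit.NavierStokesRegularity.NavierStokesRegularity.Theorems.SequentialTypeIExclusion.Registered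

open Literature.Analysis.FluidPDE Function TopologicalSpace Metric
open scoped ENNReal NNReal

/-- **Centred cubic bound + a Type-I rate relative to the point ⇒ the sub-ball bound.** If
`C(r; T, x₀) ≤ M` for `0 < r < r₁` (centred) and `max(‖x − x₀‖, √(T − t)) ‖u(t, x)‖ ≤ K` on
`Q_{r₂}(T, x₀)` (pointwise Type-I rate relative to the point `(T, x₀)`), then `C(Q(z', r')) ≤ M₁`
for every parabolic sub-ball of `Q_{R₀}(T, x₀)`, `R₀ = min(r₁/4, r₂)`,
`M₁ = max(9M, K³|B₁|)`: a sub-ball whose centre is `2r'`-far from `x₀` or `3r'²`-early sees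
`‖u‖ ≤ K/r'` pointwise, hence `C ≤ K³|B₁|`; otherwise it lies in `Q_{3r'}(T, x₀)` and
`C ≤ 9 C(3r'; T, x₀) ≤ 9M`. [folklore] -/
theorem subballC_of_supForm_of_relTypeI {T : ℝ} {u : ℝ → (EuclideanSpace ℝ (Fin 3)) → (EuclideanSpace ℝ (Fin 3))} {x₀ : (EuclideanSpace ℝ (Fin 3))} {M K r₁ r₂ : ℝ}
    (hr₁ : 0 < r₁) (hM : ∀ r ∈ Ioo 0 r₁, cknC r ((T, x₀) : ℝ × (EuclideanSpace ℝ (Fin 3))) u ≤ ENNReal.ofReal M)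
    (hr₂ : 0 < r₂) (hK : ∀ (t : ℝ) (x : (EuclideanSpace ℝ (Fin 3))), ((t, x) : ℝ × (EuclideanSpace ℝ (Fin 3))) ∈ parabolicCylinder r₂ ((T, x₀) : ℝ × (EuclideanSpace ℝ (Fin 3))) →
      max ‖x - x₀‖ (Real.sqrt (T - t)) * ‖u t x‖ ≤ K) :
    ∃ M₁ R₀ : ℝ, 0 < R₀ ∧ ∀ (r' : ℝ) (z' : ℝ × (EuclideanSpace ℝ (Fin 3))), 0 < r' →
      parabolicCylinder r' z' ⊆ parabolicCylinder R₀ ((T, x₀) : ℝ × (EuclideanSpace ℝ (Fin 3))) →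
      cknC r' z' u ≤ ENNReal.ofReal M₁ := by
  -- `K ≥ 0`: the cylinder `Q_{r₂}(T, x₀)` is nonempty
  have hK0 : 0 ≤ K := by
    have hw : ((T - r₂ ^ 2 / 2, x₀) : ℝ × (EuclideanSpace ℝ (Fin 3))) ∈ parabolicCylinder r₂ ((T, x₀) : ℝ × (EuclideanSpace ℝ (Fin 3))) := by
      rw [mem_parabolicCylinder]
      refine ⟨⟨by nlinarith, by nlinarith⟩, by simpa using hr₂⟩
    exact le_trans (by positivity) (hK _ _ hw)
  set B : ℝ≥0∞ := volume (ball (0 : (EuclideanSpace ℝ (Fin 3))) 1) with hB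
  have hBtop : B ≠ ⊤ := measure_ball_lt_top.ne
  set R₀ : ℝ := min (r₁ / 4) r₂ with hR₀def
  have hR₀ : 0 < R₀ := lt_min (by positivity) hr₂
  have hR₀r₁ : R₀ ≤ r₁ / 4 := min_le_left _ _
  have hR₀r₂ : R₀ ≤ r₂ := min_le_right _ _
  refine ⟨max (9 * M) (K ^ 3 * B.toReal), R₀, hR₀, fun r' z' hr' hsub => ?_⟩
  obtain ⟨-, -, ht1, ht2, hdist⟩ := parabolicCylinder_subset_data hr' hsub
  dsimp only at ht1 ht2 hdist
  have hr'R₀ : r' ≤ R₀ := by nlinarith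
  by_cases hnear : dist z'.2 x₀ < 2 * r' ∧ T - 3 * r' ^ 2 < z'.1
  · -- a near sub-ball lies in `Q_{3r'}(T, x₀)`
    have hsub3 : parabolicCylinder r' z' ⊆ parabolicCylinder (3 * r') ((T, x₀) : ℝ × (EuclideanSpace ℝ (Fin 3))) := by
      intro w hw
      rw [mem_parabolicCylinder] at hw ⊢
      obtain ⟨⟨h1, h2⟩, h3⟩ := hw
      refine ⟨⟨by nlinarith [hnear.2], by linarith⟩, ?_⟩
      calc dist w.2 x₀ ≤ dist w.2 z'.2 + dist z'.2 x₀ := dist_triangle _ _ _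
        _ < r' + 2 * r' := add_lt_add h3 hnear.1
        _ = 3 * r' := by ring
    have h3r : 3 * r' ∈ Ioo 0 r₁ := ⟨by positivity, by linarith⟩
    calc cknC r' z' u
        ≤ ENNReal.ofReal (3 * r' / r') ^ 2 * cknC (3 * r') ((T, x₀) : ℝ × (EuclideanSpace ℝ (Fin 3))) u :=
          Seregin2020.cknC_le_mul_of_subset (by positivity) hr' hsub3 u
      _ ≤ ENNReal.ofReal (3 * r' / r') ^ 2 * ENNReal.ofReal M := by gcongr; exact hM _ h3r
      _ = ENNReal.ofReal (9 * M) := by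
          rw [mul_div_cancel_right₀ (3 : ℝ) hr'.ne', ← ENNReal.ofReal_pow (by norm_num),
            ← ENNReal.ofReal_mul (by norm_num)]
          norm_num
      _ ≤ ENNReal.ofReal (max (9 * M) (K ^ 3 * B.toReal)) := ENNReal.ofReal_le_ofReal (le_max_left _ _)
  · -- a far sub-ball sees `‖u‖ ≤ K / r'` pointwise
    rw [not_and] at hnear
    have hbd : ∀ w ∈ parabolicCylinder r' z', ‖u w.1 w.2‖ ≤ K / r' := by
      intro w hw
      have hw₂ : w ∈ parabolicCylinder r₂ ((T, x₀) : ℝ × (EuclideanSpace ℝ (Fin 3))) :=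
        parabolicCylinder_mono hR₀.le hR₀r₂ _ (hsub hw)
      have hKw := hK w.1 w.2 hw₂
      rw [mem_parabolicCylinder] at hw
      obtain ⟨⟨h1, h2⟩, h3⟩ := hw
      have hm : r' ≤ max ‖w.2 - x₀‖ (Real.sqrt (T - w.1)) := by
        by_cases hd : dist z'.2 x₀ < 2 * r'
        · have hz1 := hnear hd
          rw [not_lt] at hz1
          refine le_max_of_le_right ?_
          calc r' = Real.sqrt (r' ^ 2) := (Real.sqrt_sq hr'.le).symm
            _ ≤ Real.sqrt (T - w.1) := Real.sqrt_le_sqrt (by nlinarith)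
        · rw [not_lt] at hd
          refine le_max_of_le_left ?_
          rw [← dist_eq_norm]
          have := dist_triangle z'.2 w.2 x₀
          rw [dist_comm z'.2 w.2] at this
          linarith
      have hm0 : 0 < max ‖w.2 - x₀‖ (Real.sqrt (T - w.1)) := hr'.trans_le hm
      calc ‖u w.1 w.2‖ ≤ K / max ‖w.2 - x₀‖ (Real.sqrt (T - w.1)) := by
            rw [le_div_iff₀ hm0, mul_comm]; exact hKw
        _ ≤ K / r' := div_le_div_of_nonneg_left hK0 hr' hm
    have hbd' : ∀ᵐ w ∂(volume.restrict (parabolicCylinder r' z')), ‖u w.1 w.2‖ ≤ K / r' := by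
      rw [ae_restrict_iff' (isOpen_parabolicCylinder r' _).measurableSet]
      exact ae_of_all _ fun w hw => hbd w hw
    calc cknC r' z' u
        ≤ ENNReal.ofReal ((K / r') ^ 3 * r' ^ 3) * B :=
          cknC_le_of_ae_bound_subset (by positivity) hbd' hr' Subset.rfl
      _ = ENNReal.ofReal (K ^ 3 * B.toReal) := by
          rw [div_pow, div_mul_cancel₀ _ (pow_ne_zero 3 hr'.ne'), ENNReal.ofReal_mul (pow_nonneg hK0 3),
            ENNReal.ofReal_toReal hBtop]
      _ ≤ ENNReal.ofReal (max (9 * M) (K ^ 3 * B.toReal)) := ENNReal.ofReal_le_ofReal (le_max_right _ _)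

/-- **`S1_sup` from the SHARED conjecture at points without Type-II spikes.** If no local Type I
singular point exists (`¬ LocalTypeISingularityExists` — Albritton–Barker 2019, Thm. 1.1, first
bullet, negated; in tree a consequence of the Liouville conjecture (L) of KNSS 2009), then for every
`M, K`, every classical Leray–Hopf solution (`ν = 1`) on `ℝ³ × [0, T)` from a rapidly decaying datum
and every `x₀`: the centred cubic Type-I bound `C(r; T, x₀) ≤ M` (`0 < r < r₁`) TOGETHER WITH a
pointwise Type-I rate relative to the point, `max(‖x − x₀‖, √(T − t)) ‖u(t, x)‖ ≤ K` on some
`Q_{r₂}(T, x₀)`, forces `u` to be bounded near `(T, x₀)`. The sup-form `S1_sup` of the crux is this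
statement without the rate clause; the tree derives it instead from the CENTRED conjecture
`¬ TypeISingularityExists` (`supForm_of_not_typeISingularityExists`). So, for S1, the two
conjectures differ exactly by the scenario of `typeIISpikes_of_not_bdd_of_not_localTypeISingularityExists`.
[cite: AlbrittonBarker2019, Thm. 1.1 and Lemma 2.6; SereginSverak2009, §2; KNSS2009, conjecture (L)] -/
theorem supForm_of_not_localTypeISingularityExists_of_relTypeI :
    ¬ Literature.Analysis.FluidPDE.LocalTypeISingularityExists →
      ∀ M K : ℝ, ∀ T : ℝ, 0 < T →
        ∀ (u : ℝ → EuclideanSpace ℝ (Fin 3) → EuclideanSpace ℝ (Fin 3))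
          (p : ℝ → EuclideanSpace ℝ (Fin 3) → ℝ),
          Literature.Analysis.FluidPDE.IsClassicalNSSolutionOn (Set.Ico 0 T) 1 0 u p →
          Literature.Analysis.FluidPDE.IsLerayHopfOn T 1 0 (u 0) u →
          Literature.Analysis.FluidPDE.HasRapidSpatialDecay (u 0) →
          ∀ x₀ : EuclideanSpace ℝ (Fin 3),
            (∃ r₁ : ℝ, 0 < r₁ ∧ ∀ r ∈ Set.Ioo 0 r₁,
              Literature.Analysis.FluidPDE.cknC r ((T, x₀) : ℝ × EuclideanSpace ℝ (Fin 3)) u ≤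
                ENNReal.ofReal M) →
            (∃ r₂ : ℝ, 0 < r₂ ∧ ∀ (t : ℝ) (x : EuclideanSpace ℝ (Fin 3)),
              ((t, x) : ℝ × EuclideanSpace ℝ (Fin 3)) ∈
                Literature.Analysis.FluidPDE.parabolicCylinder r₂ ((T, x₀) : ℝ × EuclideanSpace ℝ (Fin 3)) →
              max ‖x - x₀‖ (Real.sqrt (T - t)) * ‖u t x‖ ≤ K) →
            ∃ ρ : ℝ, 0 < ρ ∧ ∃ M : ℝ, ∀ t ∈ Set.Ioo (T - ρ ^ 2) T,
              ∀ x ∈ Metric.ball x₀ ρ, ‖u t x‖ ≤ M := by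
  intro hno M K T hT u p hsol hLH hdec x₀ hcen hrate
  obtain ⟨r₁, hr₁, hM⟩ := hcen
  obtain ⟨r₂, hr₂, hK⟩ := hrate
  exact supForm_of_not_localTypeISingularityExists_of_subballC hno T hT u p hsol hLH hdec x₀
    (subballC_of_supForm_of_relTypeI hr₁ hM hr₂ hK)

/-- **Type-II spikes must accumulate at a centred-Type-I singular point, if no local Type I
singular point exists.** Under `¬ LocalTypeISingularityExists`, at a final-time point `(T, x₀)` of a
classical Leray–Hopf solution (`ν = 1`, rapidly decaying datum) carrying a centred cubic Type-I
bound but near which `u` is NOT bounded, the Type-I rate relative to the point fails at every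
scale: for every `K` and every `r > 0` some `(t, x) ∈ Q_r(T, x₀)` has
`max(‖x − x₀‖, √(T − t)) ‖u(t, x)‖ > K` (contrapositive of
`supForm_of_not_localTypeISingularityExists_of_relTypeI`). Such spikes are regular points of `u`
(before `T`), thin enough to be invisible to the centred scale-invariant quantities; excluding them
is what the centred conjecture `¬ TypeISingularityExists` adds, for S1, to the shared one.
[cite: AlbrittonBarker2019, Thm. 1.1; SereginSverak2009, §2] -/
theorem typeIISpikes_of_not_bdd_of_not_localTypeISingularityExists :
    ¬ Literature.Analysis.FluidPDE.LocalTypeISingularityExists →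
      ∀ M : ℝ, ∀ T : ℝ, 0 < T →
        ∀ (u : ℝ → EuclideanSpace ℝ (Fin 3) → EuclideanSpace ℝ (Fin 3))
          (p : ℝ → EuclideanSpace ℝ (Fin 3) → ℝ),
          Literature.Analysis.FluidPDE.IsClassicalNSSolutionOn (Set.Ico 0 T) 1 0 u p →
          Literature.Analysis.FluidPDE.IsLerayHopfOn T 1 0 (u 0) u →
          Literature.Analysis.FluidPDE.HasRapidSpatialDecay (u 0) →
          ∀ x₀ : EuclideanSpace ℝ (Fin 3),
            (∃ r₁ : ℝ, 0 < r₁ ∧ ∀ r ∈ Set.Ioo 0 r₁,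
              Literature.Analysis.FluidPDE.cknC r ((T, x₀) : ℝ × EuclideanSpace ℝ (Fin 3)) u ≤
                ENNReal.ofReal M) →
            (¬ ∃ ρ : ℝ, 0 < ρ ∧ ∃ M : ℝ, ∀ t ∈ Set.Ioo (T - ρ ^ 2) T,
              ∀ x ∈ Metric.ball x₀ ρ, ‖u t x‖ ≤ M) →
            ∀ K r : ℝ, 0 < r → ∃ (t : ℝ) (x : EuclideanSpace ℝ (Fin 3)),
              ((t, x) : ℝ × EuclideanSpace ℝ (Fin 3)) ∈
                Literature.Analysis.FluidPDE.parabolicCylinder r ((T, x₀) : ℝ × EuclideanSpace ℝ (Fin 3)) ∧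
              K < max ‖x - x₀‖ (Real.sqrt (T - t)) * ‖u t x‖ := by
  intro hno M T hT u p hsol hLH hdec x₀ hcen hnot K r hr
  by_contra h
  push Not at h
  exact hnot (supForm_of_not_localTypeISingularityExists_of_relTypeI hno M K T hT u p hsol hLH hdec
    x₀ hcen ⟨r, hr, fun t x htx => h t x htx⟩)

end Summit.NavierStokesRegularity.NavierStokesRegularity.Theorems.SequentialTypeIExclusion.Registered

end
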